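import Summits.ValiantsHypothesis.ValiantsHypothesis.Theorems.BarrierLeverAnchoredDoorHitsLowerPairsXElimCheck

/-!
# Support item `AnchoredDoorHitsLowerPairs` (stmt-ValiantsHypothesis-22510), line `anchored-peeling`:
# SOUNDNESS OF THE BITMASK CHECKER FOR X-ELIMINATION CERTIFICATES

Helper file (`--supports stmt-ValiantsHypothesis-22510`; cell valiant-natproofs, rung V4, 𝒟-side door (c); prover seat val-np-p1 gen 26; memo
HOME/val-np-p1/g26/MEMO-conjZ-node-valnp1-g26.md §10). Closes NO item. Sequel of `…XElimCheck` (bitmask data, `check`).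

**`xcert_of_check : check h R F t = true → XElim.XCert (dRows h R) (dCols h F)`** (induction on the tree: `XCert.empty`, `XCert.leaf_of_card`,
`XCert.step_items` with the mirror lemmas `touchedBB_eq` / `capOfB_eq`), and `isXCertPair_of_check`: `decide` on literal data produces
`XElim.IsXCertPair` instances, hence profile-2 hits (`XElim.symbolicDet_ne_zero_of_isXCertPair`).

WHAT THIS IS NOT: no instance here; nothing on crux stmt-ValiantsHypothesis-14610 or on `VP` versus `VNP`.
-/

set_option linter.dupNamespace false

namespace Summit.ValiantsHypothesis.ValiantsHypothesis.Theorems.BarrierLever.AnchoredPeeling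

open Finset

namespace XElim

namespace Check

/-! ## 4. Soundness -/

section Sound

variable {h : ℕ}

/-- Decoded rows of a filtered list. -/
theorem dRows_filter (R : List ℕ) (p : ℕ → Bool) (P : Finset (Fin h) → Prop) [DecidablePred P] (hP : ∀ U ∈ R, p U = true ↔ P (ofBits h U)) :
    dRows h (R.filter p) = (dRows h R).filter P := by
  ext S
  rw [dRows, dRows, List.mem_toFinset, List.mem_map, Finset.mem_filter, List.mem_toFinset, List.mem_map]
  constructor
  · rintro ⟨U, hU, rfl⟩
    obtain ⟨hUR, hpU⟩ := List.mem_filter.mp hU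
    exact ⟨⟨U, hUR, rfl⟩, (hP U hUR).mp hpU⟩
  · rintro ⟨⟨U, hUR, rfl⟩, hPU⟩
    exact ⟨U, List.mem_filter.mpr ⟨hUR, (hP U hUR).mpr hPU⟩, rfl⟩

/-- Decoded columns of a filtered list. -/
theorem dCols_filter (F : List BCol) (p : BCol → Bool) (P : LCol h → Prop) [DecidablePred P] (hP : ∀ c ∈ F, p c = true ↔ P (dCol h c)) :
    dCols h (F.filter p) = (dCols h F).filter P := by
  ext S
  rw [dCols, dCols, List.mem_toFinset, List.mem_map, Finset.mem_filter, List.mem_toFinset, List.mem_map]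
  constructor
  · rintro ⟨c, hc, rfl⟩
    obtain ⟨hcF, hpc⟩ := List.mem_filter.mp hc
    exact ⟨⟨c, hcF, rfl⟩, (hP c hcF).mp hpc⟩
  · rintro ⟨⟨c, hcF, rfl⟩, hPc⟩
    exact ⟨c, List.mem_filter.mpr ⟨hcF, (hP c hcF).mpr hPc⟩, rfl⟩

/-- Decoded image of a mapped list. -/
theorem dRows_map (R : List ℕ) (f : ℕ → ℕ) (g : Finset (Fin h) → Finset (Fin h)) (hfg : ∀ U ∈ R, ofBits h (f U) = g (ofBits h U)) :
    dRows h (R.map f) = (dRows h R).image g := by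
  ext S
  rw [dRows, dRows, List.mem_toFinset, List.mem_map, Finset.mem_image]
  constructor
  · rintro ⟨V, hV, rfl⟩
    obtain ⟨U, hU, rfl⟩ := List.mem_map.mp hV
    exact ⟨ofBits h U, List.mem_toFinset.mpr (List.mem_map.mpr ⟨U, hU, rfl⟩), (hfg U hU).symm⟩
  · rintro ⟨T, hT, rfl⟩
    obtain ⟨U, hU, rfl⟩ := List.mem_map.mp (List.mem_toFinset.mp hT)
    exact ⟨f U, List.mem_map.mpr ⟨U, hU, rfl⟩, hfg U hU⟩

/-- Decoded image of a mapped column list. -/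
theorem dCols_map (F : List BCol) (f : BCol → BCol) (g : LCol h → LCol h) (hfg : ∀ c ∈ F, dCol h (f c) = g (dCol h c)) :
    dCols h (F.map f) = (dCols h F).image g := by
  ext S
  rw [dCols, dCols, List.mem_toFinset, List.mem_map, Finset.mem_image]
  constructor
  · rintro ⟨d, hd, rfl⟩
    obtain ⟨c, hc, rfl⟩ := List.mem_map.mp hd
    exact ⟨dCol h c, List.mem_toFinset.mpr (List.mem_map.mpr ⟨c, hc, rfl⟩), (hfg c hc).symm⟩
  · rintro ⟨T, hT, rfl⟩
    obtain ⟨c, hc, rfl⟩ := List.mem_map.mp (List.mem_toFinset.mp hT)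
    exact ⟨f c, List.mem_map.mpr ⟨c, hc, rfl⟩, hfg c hc⟩

/-- Erasing a set bit: `ofBits (U ^^^ 2^a) = (ofBits U).erase a`. -/
theorem ofBits_xor_two_pow {U : ℕ} {a : Fin h} (hU : U.testBit a.val = true) : ofBits h (U ^^^ 2 ^ a.val) = (ofBits h U).erase a := by
  rw [ofBits_xor_of_sub (by rw [ofBits_two_pow]; exact Finset.singleton_subset_iff.mpr (mem_ofBits.mpr hU)), ofBits_two_pow, Finset.sdiff_singleton_eq_erase]

/-- **SOUNDNESS OF THE CHECKER.** -/
theorem xcert_of_check : ∀ (t : CTree) (R : List ℕ) (F : List BCol), check h R F t = true → XCert (dRows h R) (dCols h F)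
  | .empty, R, F, hc => by
    rw [check, Bool.and_eq_true, List.isEmpty_iff, List.isEmpty_iff] at hc
    obtain ⟨rfl, rfl⟩ := hc
    rw [dRows, dCols, List.map_nil, List.map_nil, List.toFinset_nil, List.toFinset_nil]
    exact XCert.empty
  | .leaf, R, F, hc => by
    rcases R with _ | ⟨U, _ | ⟨U', R'⟩⟩ <;> rcases F with _ | ⟨c, _ | ⟨c', F'⟩⟩ <;>
      simp only [check, Bool.false_eq_true] at hc
    -- the genuine leaf `R = [U]`, `F = [c]`
    simp only [leafOK, Bool.and_eq_true, Bool.or_eq_true, decide_eq_true_eq, Bool.not_eq_true'] at hc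
    obtain ⟨⟨⟨hU, hvc⟩, hle⟩, h0⟩ := hc
    have hc2 : c.2 < 2 ^ h := by
      simp only [validC, Bool.and_eq_true, decide_eq_true_eq] at hvc; exact hvc.1
    rw [dRows, dCols, List.map_singleton, List.map_singleton, List.toFinset_cons, List.toFinset_nil, Finset.insert_empty,
      List.toFinset_cons, List.toFinset_nil, Finset.insert_empty, dCol]
    refine XCert.leaf_of_card (ofBits h U) (ofBits h c.2) _ (fun hne => ?_) (fun hW hL => ?_)
    · rcases hle with h0' | hle'
      · exact absurd ((ofBits_eq_empty_iff hc2).mpr h0') (Finset.nonempty_iff_ne_empty.mp hne)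
      · rw [card_ofBits, card_ofBits]; exact hle'
    · have hz : c.2 = 0 := (ofBits_eq_empty_iff hc2).mp hW
      have hnil : c.1 = [] := by
        have : (c.1.map (dAnch h)).toFinset = ∅ := hL
        rw [List.toFinset_eq_empty_iff, List.map_eq_nil_iff] at this
        exact this
      rcases h0 with (h0 | h0) | h0
      · exact absurd (decide_eq_true hz) (by rw [h0]; exact Bool.false_ne_true)
      · rw [hnil] at h0; exact absurd h0 (by simp)
      · rw [h0]; exact (ofBits_eq_empty_iff (by positivity)).mpr rfl
  | .step a its t0 t1, R, F, hc => by
    rw [check] at hc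
    simp only [Bool.and_eq_true, decide_eq_true_eq] at hc
    obtain ⟨⟨⟨⟨⟨⟨ha, hR⟩, hF⟩, hits⟩, hfr⟩, h0⟩, h1⟩ := hc
    have ih0 := xcert_of_check t0 _ _ h0
    have ih1 := xcert_of_check t1 _ _ h1
    have hF' : ∀ c ∈ F, validC h c = true := List.all_eq_true.mp hF
    have hR' : ∀ U ∈ R, U < 2 ^ h := fun U hU => of_decide_eq_true (List.all_eq_true.mp hR U hU)
    refine XCert.step_items (⟨a, ha⟩ : Fin h) (its.map (dAnch h)) (dRows h R) (dCols h F) ?_ ?_ ?_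
    · -- freshness
      intro c hc ℓ hℓ
      rw [dCols, List.mem_toFinset, List.mem_map] at hc
      obtain ⟨cb, hcb, rfl⟩ := hc
      rw [dCol] at hℓ
      obtain ⟨p, hp, rfl⟩ := List.mem_map.mp (List.mem_toFinset.mp hℓ)
      have hpa : ¬ p.1 = 2 ^ a := by
        have := List.all_eq_true.mp (List.all_eq_true.mp hfr cb hcb) p hp
        simpa using this
      intro he
      have hv : validP h p = true := by
        have := hF' cb hcb; simp only [validC, Bool.and_eq_true, List.all_eq_true] at this; exact this.2 p hp
      simp only [validP, Bool.and_eq_true, decide_eq_true_eq] at hv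
      rw [dAnch] at he
      exact hpa (ofBits_inj hv.1 (Nat.pow_lt_pow_right (by norm_num) ha) (he.trans (ofBits_two_pow (⟨a, ha⟩ : Fin h)).symm))
    · -- TOP
      rw [← dRows_filter R (fun U => !U.testBit a) (fun S => (⟨a, ha⟩ : Fin h) ∉ S) (fun U _ => by
            rw [mem_ofBits, Bool.not_eq_true', Bool.not_eq_true]),
        ← dCols_filter F (fun c => !touchedBB h a its c) (fun d => touchedB (⟨a, ha⟩ : Fin h) (its.map (dAnch h)) d = false) (fun c hc => by
            rw [touchedBB_eq hits (hF' c hc), Bool.not_eq_true'])]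
      exact ih0
    · -- BOT
      rw [← dRows_filter R (fun U => U.testBit a) (fun S => (⟨a, ha⟩ : Fin h) ∈ S) (fun U _ => by rw [mem_ofBits]),
        ← dRows_map _ (fun U => U ^^^ 2 ^ a) (fun S => S.erase (⟨a, ha⟩ : Fin h)) (fun U hU => by
            obtain ⟨_, hbit⟩ := List.mem_filter.mp hU
            exact ofBits_xor_two_pow (a := (⟨a, ha⟩ : Fin h)) hbit),
        ← dCols_filter F (fun c => touchedBB h a its c) (fun d => touchedB (⟨a, ha⟩ : Fin h) (its.map (dAnch h)) d = true) (fun c hc => by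
            rw [touchedBB_eq hits (hF' c hc)]),
        ← dCols_map _ (capOfB h a its) (capOf (⟨a, ha⟩ : Fin h) (its.map (dAnch h))) (fun c hc => by
            obtain ⟨hcF, _⟩ := List.mem_filter.mp hc
            exact (capOfB_eq (a := (⟨a, ha⟩ : Fin h)) hits (hF' c hcF)).symm)]
      exact ih1

/-- **Instances from the checker:** a pair of injective enumerations whose images are the decoded data is a certificate pair. -/
theorem isXCertPair_of_check {r : ℕ} (u w : Fin r → Finset (Fin h)) (R : List ℕ) (F : List ℕ) (t : CTree)
    (hR : Finset.univ.image u = dRows h R) (hF : Finset.univ.image (fun j => ((∅ : Finset (Anchor h)), w j)) = dCols h (F.map (fun W => ([], W))))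
    (hc : check h R (F.map (fun W => ([], W))) t = true) : IsXCertPair u w := by
  rw [IsXCertPair, hR, hF]
  exact xcert_of_check t R _ hc


/-- **Profile-2 hits from the checker, for EVERY pair of injective enumerations of the decoded families.** -/
theorem symbolicDet_two_ne_zero_of_check (R Ws : List ℕ) (t : CTree) (hc : check h R (Ws.map (fun W => (([] : List (ℕ × ℕ)), W))) t = true)
    {r : ℕ} (u w : Fin r → Finset (Fin h)) (hu : Function.Injective u) (hw : Function.Injective w)
    (hru : Set.range u = ↑(dRows h R)) (hrw : Set.range w = ↑((Ws.map (ofBits h)).toFinset)) : symbolicDet 2 h r u w ≠ 0 := by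
  classical
  obtain ⟨Θ, Φ, Ψ, n, u', κ', hu', hκ', hru', hrκ', hdet⟩ := good_of_xcert (xcert_of_check t R _ hc)
  set κ : Fin r → LCol h := fun j => ((∅ : Finset (Anchor h)), w j) with hκ
  have hκinj : Function.Injective κ := fun j j' hjj => hw (congrArg Prod.snd hjj)
  have hcols : (↑(dCols h (Ws.map (fun W => (([] : List (ℕ × ℕ)), W)))) : Set (LCol h)) = Set.range κ := by
    ext c
    rw [dCols, List.map_map, Finset.mem_coe, List.mem_toFinset, List.mem_map, Set.mem_range]
    constructor
    · rintro ⟨W, hW, rfl⟩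
      have : ofBits h W ∈ Set.range w := by
        rw [hrw, Finset.mem_coe, List.mem_toFinset, List.mem_map]; exact ⟨W, hW, rfl⟩
      obtain ⟨j, hj⟩ := this
      refine ⟨j, ?_⟩
      rw [hκ]; simp only [Function.comp_apply, dCol, List.map_nil, List.toFinset_nil]; rw [hj]
    · rintro ⟨j, rfl⟩
      have : w j ∈ (↑((Ws.map (ofBits h)).toFinset) : Set _) := by rw [← hrw]; exact ⟨j, rfl⟩
      rw [Finset.mem_coe, List.mem_toFinset, List.mem_map] at this
      obtain ⟨W, hW, hWj⟩ := this
      exact ⟨W, hW, by simp only [Function.comp_apply, dCol, List.map_nil, List.toFinset_nil]; rw [hWj]⟩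
  have hn : n = r := by
    rw [card_eq_of_range_eq hu' hru']
    have := card_eq_of_range_eq hu hru
    exact this.symm
  have hdet' := det_lmat_ne_zero_of_range_eq Θ Φ Ψ (u := u') (κ := κ') (u' := u) (κ' := κ) hu' hκinj (by rw [hru, hru'])
    (by rw [← hcols, hrκ']) hn hdet
  have hmat : (Matrix.of fun i j : Fin r => P2.p2Entry Θ Φ (w j) (u i)) = lmat Θ Φ Ψ u κ := by
    ext i j; rw [Matrix.of_apply, lmat, Matrix.of_apply, hκ, entry_empty_labels]
  exact P2.symbolicDet_two_ne_zero_of_p2Entry Θ Φ u w (by rw [hmat]; exact hdet')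

end Sound

end Check

end XElim

end Summit.ValiantsHypothesis.ValiantsHypothesis.Theorems.BarrierLever.AnchoredPeeling
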